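import Mathlib
import HarnessLib
import HarnessLib.Audit
import Summits.CriticalPhenomena.Statement
import Literature.Probability.RandomPlanarGeometry.SAWParafermion

/-!
Route: SAWAlgebraicCriticalPoint

CLOSED (retired) 2026-08-15T13:48:03Z by operator:999:1257524 — reason: not-a-thesis: assembly does not conclude the sub-problem Statement — note: D-0027 §2.1 audit (human 2026-08-15: routes that do not decide the summit are removed): the assembly concludes `NoCriticalStencilIdentity`, not the sub-problem statement; a NEW conforming route may be opened from the same idea (generated `closes : … → _root_.SAWScalingLimit`).. The file is kept as the record of this route; refuted decls are indexed as negative knowledge (`ledger negatives`).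

# Route SAWAlgebraicCriticalPoint — Exactly critical-holomorphic only at an algebraic fugacity —
finite SAW stencil identities on Z^2 one size up (barrier route)

BARRIER ROUTE (D-0021 negative knowledge), realising idea card algebraic-critical-point-dichotomy.
Declared up front: X does NOT imply Summit.CriticalPhenomena.SAWScalingLimit and is not claimed to;
X is a no-go theorem schema for the technique class "exact finite linear identity for the uniform ℤ²
SAW observable" (the class of DCS Lemma 1 and of
Literature.Barriers.CriticalPhenomena.HasExactVertexRelationZ2, taken one stencil size up), the
Assembly's conclusion is X, and the deliverable is Theorems files that a literature seat can vendor
into Literature/Barriers/CriticalPhenomena (AlgebraicCriticalPointDichotomy) plus evidence for route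
SAWParafermion's guard NoExactVertexRelation (stmt-CriticalPhenomena-0792).
It suffices to show X = NoCriticalStencilIdentity = (A) ∧ (B). Setting: the mid-edge parafermionic
observable F^{x,σ}_{Ω,a}(e) =
Literature.Probability.RandomPlanarGeometry.SAW.midEdgeParafermionicObservable Ω δ a x σ e of the
uniform SAW in a BOUNDED discrete domain Ω_δ ⊆ δℤ², rooted at a LEAF boundary vertex a (a lattice
neighbour outside Ω, exactly one neighbour in Ω_δ), rational spin σ ∈ [0,4) (spins matter mod 4
since windings lie in (π/2)ℤ); an exact radius-2 stencil identity is a coefficient table c ≠ 0 on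
the 16 edges incident to the ball B₁(v) = {v, v±e₀, v±e₁} with Σ_e c_e F^{x,σ}_{Ω,a}(e) = 0 at EVERY
placement v whose ball is 4-valent in Ω_δ, in EVERY bounded domain, for EVERY leaf root. (A): such
an identity at x = x_c = 1/μ(ℤ²) (criticalFugacity) forces x_c — hence μ — to be an algebraic
number. (B): no such identity holds at any x ∈ (0,1), for any rational spin. The organising lemma is
the card's Claim D (support StencilDichotomy, provable now): for EVERY finite stencil type the set
of fugacities carrying an identity is either all of ℝ (a fugacity-blind family, algebraic in x) or a
finite set of algebraic numbers — so an x_c-specific identity certifies μ algebraic, and the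
conditional no-go for a type is decided by ONE exact nullspace computation over ℚ(ζ)(x) that needs
no knowledge of μ.
Lean: `let Rel : (m : ℕ) → (Fin m → ℚ) → Finset (Literature.Probability.LatticeModels.Site 2) →
Finset (Literature.Probability.LatticeModels.Site 2 × Fin 2) → (Fin m →
Literature.Probability.LatticeModels.Site 2 → Fin 2 → ℂ) → ℝ → Prop := fun m σ G E c x => ∀ (Ω :
_root_.Set ℂ) (δ : ℝ) (a v : Literature.Probability.LatticeModels.Site 2), 0 < δ →
Bornology.IsBounded Ω → a ∈ Literature.Probability.LatticeModels.meshDomain Ω δ → (∃ w :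
Literature.Probability.LatticeModels.Site 2, (Literature.Probability.LatticeModels.zdGraph 2).Adj a
w ∧ Literature.Probability.LatticeModels.meshPoint δ w ∉ Ω) → (∃! u :
Literature.Probability.LatticeModels.Site 2,
(Literature.Probability.LatticeModels.discreteDomainGraph Ω δ).Adj a u) → (∀ p ∈ G, ∀ i : Fin 4,
(Literature.Probability.LatticeModels.discreteDomainGraph Ω δ).Adj (v + p) (v + p + (![![1, 0], ![0,
1], ![-1, 0], ![0, -1]] : Fin 4 → Literature.Probability.LatticeModels.Site 2) i)) → ∑ j : Fin m, ∑
e ∈ E, c j e.1 e.2 * Literature.Probability.RandomPlanarGeometry.SAW.midEdgeParafermionicObservable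
Ω δ a x (σ j) s(v + e.1, v + e.1 + Pi.single e.2 1) = 0; let B1 : Finset
(Literature.Probability.LatticeModels.Site 2) := {0, ![1, 0], ![0, 1], ![-1, 0], ![0, -1]}; let E2 :
Finset (Literature.Probability.LatticeModels.Site 2 × Fin 2) := {(0, 0), (0, 1), (![-1, 0], 0),
(![0, -1], 1), (![1, 0], 0), (![1, 0], 1), (![1, -1], 1), (![0, 1], 0), (![0, 1], 1), (![-1, 1], 0),
(![-1, 0], 1), (![-2, 0], 0), (![-1, -1], 1), (![0, -1], 0), (![-1, -1], 0), (![0, -2], 1)}; (∀ (σ :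
ℚ) (c : Literature.Probability.LatticeModels.Site 2 → Fin 2 → ℂ), 0 ≤ σ → σ < 4 → (∃ e ∈ E2, c e.1
e.2 ≠ 0) → Rel 1 (fun _ => σ) B1 E2 (fun _ => c)
Literature.Probability.RandomPlanarGeometry.SAW.criticalFugacity → IsAlgebraic ℚ
Literature.Probability.RandomPlanarGeometry.SAW.criticalFugacity) ∧ (∀ (σ : ℚ) (x : ℝ) (c :
Literature.Probability.LatticeModels.Site 2 → Fin 2 → ℂ), 0 ≤ σ → σ < 4 → 0 < x → x < 1 → (∃ e ∈ E2,
c e.1 e.2 ≠ 0) → ¬ Rel 1 (fun _ => σ) B1 E2 (fun _ => c) x)`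

## Assembly
Pure logic (checked in the planner's Sketch.lean, theorem assembly_holds): given a non-trivial
radius-2 identity at x_c, StencilDichotomy (with m = 1) yields IsAlgebraic ℚ x_c or a fugacity-blind
family of the same type, and the latter contradicts NoFugacityBlindFamilyR2 (Fin 1 bookkeeping
only); conjunct (B) is NoRadiusTwoRelation verbatim. The conclusion is the barrier statement X, NOT
Summit.CriticalPhenomena.SAWScalingLimit (declared barrier route).

Rationale: WHY THIS LINE. Every exactly-solved planar critical point (Ising √2−1, hexagonal SAW 1/√(2+√2) via
DuminilCopinSmirnov2012 Lemma 1, FK/percolation, the Nienhuis/Yang–Baxter weights singled out by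
discrete holomorphicity in IkhlefCardy2009 §3 and arXiv:1402.0937) is algebraic, and
Jacobsen–Scullard's critical-polynomial philosophy records the empirical dichotomy "finite-size
condition with a root EXACTLY at the critical point ⇔ solvable; else roots only converge"
(JacobsenScullardGuttmann2016 p.8; Jacobsen2015: μ_H exact at every size, 'reminiscent of the DCS
identity'), while μ(ℤ²) = 2.63815853032790(3) has resisted every closed form (Guttmann's quartic
13t⁴−7t²−581 'too low by about 2·10⁻¹²', ibid. p.3) and the square-lattice walk is 'not believed to
be integrable … nor the existence of a well-behaved equivalent observable' (GlazmanManolescu2019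
p.1). The card turns this folklore into a lemma read in the converse direction — a finite identity
with cyclotomic coefficients holding exactly at x_c makes x_c a root of a non-zero minor in ℚ(ζ)[x],
unless the identity holds at every fugacity — importing nothing deeper than elimination/linear
algebra over a function field and the notion of algebraic number (Mathlib IsAlgebraic), i.e.
transcendence theory only as bookkeeping. What the line does that the tree does not: the audited
barrier theorem Literature.Barriers.CriticalPhenomena.not_hasExactVertexRelationZ2 empties the
4-term single-vertex class for all (x,σ) but its scope_caveats (b) leave 'larger or multi-vertex
stencils' open and exhibit walk-wise trivial ALL-x families in the half-edge variant; this route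
types the next class (16 mid-edge values on the radius-1 ball, leaf roots, where multi-character
weights provably decouple — support CharacterDecoupling), files its two decidable statements
(fugacity-blind families: NoFugacityBlindFamilyR2; any identity in (0,1): NoRadiusTwoRelation), and
delivers the all-types dichotomy that prices every future 'exact identity on ℤ²' proposal (cards
charge-and-quarter-turn-closure, phase-free-harmonic-observable and
argument-over-modulus-parafermion all work with approximate identities, consistently). No unproved
cone fact is used anywhere: x_c ∈ (0,1) (LawlerSchrammWerner2004SAW bounds, cited not proved) is
deliberately NOT needed, which is why (A) is derived from the dichotomy and not from (B).

RANKED CRUXES. #0 NoCriticalStencilIdentity (target) — X = (A) ∧ (B): (A) a non-trivial exact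
radius-2 stencil identity (rational spin in [0,4), 16 edges incident to the 4-valent ball B₁(v), all
bounded domains, all leaf roots) for the ℤ² mid-edge SAW observable at x = criticalFugacity forces
IsAlgebraic ℚ criticalFugacity; (B) no such identity holds at any x ∈ (0,1). (why it might fail: (B)
fails if an isolated algebraic (x,σ) solution survives all domains at radius 2; (A) is then still
provable unless a fugacity-blind family exists (NoFugacityBlindFamilyR2 false).)
[Literature.Barriers.CriticalPhenomena.not_hasExactVertexRelationZ2, JacobsenScullardGuttmann2016,
GlazmanManolescu2019, IkhlefCardy2009]
#2 NoFugacityBlindFamilyR2 (crux) — [card r3 'all-x nullspace scan', radius 2] for every rational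
spin σ ∈ [0,4) there is NO fugacity-blind family: it is not the case that for every real x some
non-trivial coefficient table on the 16 edges incident to B₁(v) gives an exact identity Σ_e c_e
F^{x,σ}(e) = 0 on all bounded domains, leaf roots and 4-valent placements. Decidable per spin class
by exact linear algebra over ℚ(ζ)(x) (rank of the stacked relation matrix of finitely many domains);
most informative item: its failure is an exact 'massive' discrete holomorphicity for the ℤ² SAW, its
success makes (A) a theorem. [difficulty: L] (why it might fail: A fugacity-blind identity could
come from walk-wise phase cancellations richer than single-walk ones: the half-edge variant already
carries all-x families 1+λt+λ̄t⁻¹=0 at special spins (barrier scope_caveats (b)), and the 16-value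
radius-2 space has never been scanned.)
[Literature.Barriers.CriticalPhenomena.NienhuisWeightsExcludeVertexSAW, IkhlefCardy2009,
arXiv:1402.0937, GlazmanManolescu2019]
#3 NoRadiusTwoRelation (crux) — [unconditional extension of the audited no-go one stencil size up]
for every rational spin σ ∈ [0,4), every x ∈ (0,1) and every non-trivial coefficient table on the 16
edges incident to B₁(v), the exact identity fails in some bounded domain with a leaf root at some
4-valent placement. Route to a proof: NoFugacityBlindFamilyR2's certificate (full column rank over
ℚ(ζ)(x)) plus exclusion of the finitely many common roots of the maximal minors in (0,1) by one more
domain each, as in the audit's elimination (vertexStencil_eq_zero_of_rows); the audit's plus-shaped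
domains impose nothing here (no 4-valent ball), so new certificate domains are needed. [deps:
NoFugacityBlindFamilyR2] [difficulty: L] (why it might fail: Isolated (x,σ) solutions do occur
domain-by-domain — the 3×3, 4×3, 5×5 blocks admit block-dependent spins σ≈0.605 with the CR stencil
(barrier scope_caveats (a)); with 16 coefficients an isolated algebraic pair might survive every
domain.) [Literature.Barriers.CriticalPhenomena.not_hasExactVertexRelationZ2,
DuminilCopinSmirnov2012, BeatonGuttmannJensen2012, GlazmanManolescu2019]
#9 StencilDichotomy (support) — [the card's Claim D, instantiated; provable now] for every finite
stencil type (m rational spins, any finite guard G of offsets required 4-valent, any finite set E of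
canonical edges, coefficients c ≠ 0 on E) and every real x₀: if the exact identity holds at x₀ on
all bounded domains / leaf roots / guarded placements, then x₀ is algebraic over ℚ OR for every real
x some non-trivial c' of the same type gives the identity at x (a fugacity-blind family). Proof
sketch: on a bounded domain each F^{x,σ}(e) is a polynomial in x with coefficients in ℤ[ζ_N] (finite
sum of e^{-iσW}x^n, W ∈ (π/2)ℤ); if some x₁ carries no identity, finitely many domains already kill
it, a maximal minor D ∈ ℚ(ζ_N)[x] of their stacked matrix is non-zero and vanishes at x₀.
[difficulty: M] [JacobsenScullardGuttmann2016, IkhlefCardy2009]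
#9 AbstractDichotomy (support) — [pure algebra behind StencilDichotomy; provable now] for any family
of row vectors of polynomials over ℂ with algebraic coefficients (rows indexed by an arbitrary type,
n columns) and x₀ ∈ ℂ: if the rows evaluated at x₀ have a common non-zero kernel vector then either
x₀ is algebraic over ℚ or the rows evaluated at every x ∈ ℂ have a common non-zero kernel vector.
(Finite-dimensional descending-chain argument + one non-vanishing maximal minor; no Noetherianity,
no function fields needed.) [difficulty: provable-now] [JacobsenScullardGuttmann2016]
#9 CharacterDecoupling (support) — [why single spins suffice; provable now] on leaf-rooted bounded
domains a multi-character identity (spins pairwise distinct mod 4, stencil edges within reach of the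
guard, x ≠ 0) holds only if each single-character component holds separately. Proof sketch: prefix
the domain by a width-1 corridor spiralling s times around it and starting in an arbitrary direction
— every walk acquires the same extra winding k₀ (any integer is realisable) and length, so the
identity for the composite domain reads Σ_j t_j^{k₀} EQ_j = 0 with t_j = e^{-iπσ_j/2} pairwise
distinct: a Vandermonde system forcing EQ_j = 0 for each j. Hence the card's 'winding-class memory'
adds nothing at fixed stencil, and (A)/(B) extend verbatim to arbitrary finite spin sets.
[difficulty: M] [DuminilCopinSmirnov2012,
Literature.Barriers.CriticalPhenomena.NienhuisWeightsExcludeVertexSAW]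
#9 NoVertexRelationLeaf (support) — [radius-1 calibration = the audited barrier theorem in this
route's conventions; provable now] for every rational spin, every x ∈ (0,1) and every non-trivial
table on the 4 edges at v, the single-vertex identity (guard {v}) fails on some bounded leaf-rooted
domain — adapt Literature.Barriers.CriticalPhenomena.not_hasExactVertexRelationZ2 (its six domains
P, T, O are bounded and every root used is a leaf; the enumeration lemmas
Literature.Barriers.CriticalPhenomena.NoVertexRelation.* are reusable). [difficulty: provable-now]
[Literature.Barriers.CriticalPhenomena.not_hasExactVertexRelationZ2, DuminilCopinSmirnov2012]

TWO-LAYER PLAN. Foreseen glued splits, none filed now: NoRadiusTwoRelation ⇐ NoFugacityBlindFamilyR2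
→ RootExclusionR2 → NoRadiusTwoRelation (RootExclusionR2: the gcd of the maximal minors of a
certificate set of domains has no root (x, e^{-iπσ/2}) with x ∈ (0,1), σ ∈ ℚ — Sturm/cyclotomic
elimination); StencilDichotomy ⇐ AbstractDichotomy → ObservablePolynomial → StencilDichotomy
(ObservablePolynomial: on a bounded domain the mid-edge observable at rational spin is
Polynomial.eval x of a polynomial with cyclotomic coefficients — bookkeeping over DomainSAW
finiteness). After NoFugacityBlindFamilyR2 closes either way: the all-radii statement
NoFugacityBlindFamilyAll (every finite guard/stencil; structural proof by lowest x-degree and unique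
lattice geodesics from a corridor attached collinear with a chosen stencil edge) becomes the next
ranked crux, and CharacterDecoupling-glue extends (A)/(B) to arbitrary finite spin sets.

KILL CRITERIA. NoFugacityBlindFamilyR2 REFUTED (an explicit fugacity-blind radius-2 identity proved
on all domains): (A) dies as typed — restate X modulo the found family (`--restate`) AND hand the
identity to route SAWParafermion's ObservableLimit provers (it would be an exact massive discrete
holomorphicity for the ℤ² SAW: major positive news, not a loss). NoRadiusTwoRelation REFUTED by an
isolated solution at x outside the rigorous window [1/2.6792, 1/2.6200] ∌? — restate (B) excluding
it; at x inside the window: pivot the whole route to verifying that identity on larger domains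
(candidate exact critical identity). StencilDichotomy/AbstractDichotomy cannot be refuted unless
mis-typed (then set-signature). A proof elsewhere that μ(ℤ²) is algebraic moots the transcendence
READING of (A) but not (A) or (B); a proof of transcendence (out of reach) would upgrade (A) to an
unconditional no-go for every finite type at once.

NOT DECOMPOSED YET. Memory-k observables (weights depending on the last k steps — the card's second
enlargement axis; needs a new Literature definition, deferred until a crux uses it); stencils on the
VERTEX observable parafermionicObservable; real irrational spins (covered by the audit's method at
radius 1, but the dichotomy needs algebraic phases); the hexagonal calibration (the DCS type's
identity set is exactly {x_c(hex)} — the algebraic branch realised); the PSLQ numerics of the card's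
r4, dropped as uninformative per the novelty audit (14 known digits against ≥ 30 digits of freedom);
the 'all finite types' structural no-go (Two-layer plan). Constants of certificate domains (which
blocks/annuli, how many) are the provers' business.

CHEAPEST FALSIFIER. The card's r3 scan at radius 2, which refuters should run first: enumerate SAWs
on ~10 small leaf-rooted domains containing 4-valent balls (3×4 … 5×5 blocks with a pendant corridor
root on each side, and the audit's annular T/O shapes thickened by one layer), build the relation
matrix (rows = (domain, root, placement), 16 columns) with entries in ℤ[t,t⁻¹][x], and compute its
rank over ℚ(x,t) and at t a root of unity of order ≤ 96: full column rank ⇒ NoFugacityBlindFamilyR2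
holds for all but the finitely many exceptional spin classes the same computation lists (and the
matrix is the Lean certificate); a rank drop that persists when domains are added ⇒
NoFugacityBlindFamilyR2 is refuted with an explicit candidate identity. Minutes of computer algebra;
NOT run in this one-shot planning seat (no kit job was submitted) — flagged as the first refuter
action. Lookup already done: the tree's audit (scope_caveats (a)) reports numerically that 3×4 and
4×4 blocks admit no 4-term relation while 3×3, 4×3, 5×5 admit isolated block-dependent spins — the
radius-2 analogue of exactly this table decides r2/r3.

NUMBERS. μ(ℤ²) = 2.63815853032790(3) (JacobsenScullardGuttmann2016, final estimate;
ClisbyJensen2012: 2.63815853035(2)); rigorous window 2.6200 ≤ μ ≤ 2.6792 (Finch 2003 Table 5.2; tree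
fact
Literature.Probability.RandomPlanarGeometry.SAW.LawlerSchrammWerner2004SAW_connectiveConstant_bounds:
2.6 ≤ μ ≤ 2.7, cited, not proved — and not used by this route); Guttmann's quartic 13t⁴−7t²−581 has
root 2.6381585303417… 'too low by about 2·10⁻¹²' (JacobsenScullardGuttmann2016 p.3) yet lies INSIDE
the rigorous window, so no algebraic candidate for μ can be excluded unconditionally today; x_c(hex)
= 1/√(2+√2) (DuminilCopinSmirnov2012 Thm 1) is algebraic, consistently with the dichotomy; audit
numerics at radius 1: isolated block spins σ ≈ 0.60486 (3×3), 0.60497/0.60588 (4×3), 0.60714 (5×5),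
none on 3×4, 4×4 (min |Σcᵢ Fᵢ|/Σ|Fᵢ| ≈ 2·10⁻⁵, 2·10⁻⁶) (barrier scope_caveats (a)); stencil sizes:
radius 1 = 4 unknowns (audited, empty), radius 2 = 16 unknowns per character (this route).

DEFINITION REQUESTS. None filed at open. Deferred: a finite-memory SAW observable (weights on the
last k steps) under Literature/Probability/RandomPlanarGeometry, to be requested only when a
memory-k crux is filed. Acquisition pending (not blocking): acq-02345 (Yang–Zhou 2024, Comment on
Jacobsen2015, doi:10.1088/1751-8121/ad4d2c).

Novelty: Searches (2026-08-15): lit search --hybrid "connective constant square lattice algebraic number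
closed form" (8 held-book hits: Finch 2003 §5.10 pp.343–344 read, Janse van Rensburg 2015, Grimmett
2010/2018 — bounds and estimates only, nothing linking identities to algebraicity); lit search
--source zbmath "Alam Batchelor integrability discrete holomorphicity" (2: arXiv:1207.3883,
arXiv:1402.0937); --source crossref "critical points Potts O(N) models eigenvalue identities
periodic Temperley-Lieb" (Jacobsen2015 + the 2024 Comment/Reply doi:10.1088/1751-8121/ad4d2c,
doi:10.1088/1751-8121/ad4d33 — paywalled, acq-02345 filed); zbmath "transcendental critical point
lattice model connective constant irrational" (0); lit frontier CriticalPhenomena --since 2020 (30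
rows; SAW-relevant only arXiv:2310.17299, sub-ballisticity on Hex); lit bridges CriticalPhenomena
--cross any (30 rows, none on exact identities); lit galaxy search --star all "connective constant
algebraic" (0 rows), "discretely holomorphic parafermion" (1 row, Ikhlef–Fendley network model,
unrelated); reads: arXiv:1607.02984 pp.2–3, 8 (JacobsenScullardGuttmann2016), arXiv:1007.0575 pp.3,
7 (DuminilCopinSmirnov2012: 'our methods do not directly apply to the square lattice'; the
divergence-free/curl remark concerns Hex), the barrier file NienhuisWeightsExcludeVertexSAW.lean
(scope_caveats (a)–(c)), the card's novelty audit
(refuter-novelty-audit-CriticalPhenomena-SAWScalingLimit-4-0), ledger negatives --problem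
CriticalPhen  [refs: 10.1088/1751-8121/ad4d2c, 10.1088/1751-8121/ad4d33, 1207.3883, 1402.0937, 2310.17299, 1607.02984, 1007.0575, doi:10.1088/1751-8121/ad4d2c, doi:10.1088/1751-8121/ad4d33, Jacobsen2015, JacobsenScullardGuttmann2016, DuminilCopinSmirnov2012, IkhlefCardy2009, GlazmanManolescu2019]

Barriers (technique_class: algebraic-critical-point-dichotomy, exact-local-relation): - technique_class: algebraic-critical-point-dichotomy, exact-local-relation
- Literature.Barriers.CriticalPhenomena.NienhuisWeightsExcludeVertexSAW: it does not evade it — it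
EXTENDS it: the barrier's technique class HasExactVertexRelationZ2 (4-term stencil, emptied for all
(x,σ) by not_hasExactVertexRelationZ2) is this route's radius-1 calibration item
NoVertexRelationLeaf; NoRadiusTwoRelation is the same emptiness claim one stencil size up (16 terms,
guard = 4-valent ball), NoFugacityBlindFamilyR2 its fugacity-blind half, and StencilDichotomy prices
every larger stencil conditionally on transcendence of μ; the barrier's scope_caveats (b) ('NO
theorem here excludes … larger or multi-vertex stencils'; half-edge variant has trivial all-x
families) is exactly the gap addressed, and half-edge components are excluded by design for that
reason.
- Literature.Barriers.CriticalPhenomena.ParafermionicHalfCauchyRiemann: orthogonal — it concerns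
under-determination of the EXISTING hexagonal identity (V ≈ 2E/3 relations); here the question is
existence of any exact identity on ℤ²; nothing to evade.
- Literature.Barriers.CriticalPhenomena.FKParafermionicHalfCauchyRiemann: same remark for the FK
observable; not met.
- Literature.Barriers.CriticalPhenomena.SAPAnisotropicNotDFinite: same moral family (no exact
solution of square-lattice SAW inside a tame class) but logically independent — non-holonomy of the
anisotropic polygon generating function neither implies nor follows from algebraicit

Novelty grade: new-combination — ROUTE REVIEW (refuter-rreview 0d548a29; full memo = evidence file on stmt-6408). VERDICT: sound BARRIER route — cruxes precise, typed (target rc0 in my W1.lean), non-vacuous, not in negatives; BUT Assembly 6415 concludes X = NoCriticalStencilIdentity, not Summit…SAWScalingLimit: the "not-a-thesis" s (refuter refuter-rreview-route-CriticalPhenomena--0d548a29-0, 2026-08-15T14:00:14Z; prior: JacobsenScullardGuttmann2016 (arXiv:1607.02984), Jacobsen2015, DuminilCopinSmirnov2012 (arXiv:1007.0575), Literature.Barriers.CriticalPhenomena.not_hasExactVertexRelationZ2, BeatonGuttmannJensen2012, IkhlefCardy2009, GlazmanManolescu2019 (arXiv:1708.00395))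

History (route lifecycle, newest last):
- 2026-08-15T13:48:03Z · CLOSED retired — not-a-thesis: assembly does not conclude the sub-problem Statement (operator:999:1257524)

sub-problem: SAWScalingLimit · status: closed(retired) · opened planner-plancard-CriticalPhenomena-SAWScaling-a4bde72f-0 2026-08-15T11:46:29Z · rev 0 · ledger route-CriticalPhenomena-SAWAlgebraicCriticalPoint
GENERATED by the gate from the ledger (D-0016/17). Provers cite these decls: `theorem foo : Summit.CriticalPhenomena.SAWScalingLimit.Theses.SAWAlgebraicCriticalPoint.<Decl> := …` in Summits/CriticalPhenomena/SAWScalingLimit/Theorems/<Name>.lean.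
-/

namespace Summit.CriticalPhenomena.SAWScalingLimit.Theses.SAWAlgebraicCriticalPoint

open scoped BigOperators Topology Manifold Classical MeasureTheory ProbabilityTheory Matrix InnerProductSpace ComplexConjugate ContinuousMap
open Filter Set Function TopologicalSpace MeasureTheory

attribute [summit_statement] _root_.SAWScalingLimit

/-- item stmt-CriticalPhenomena-6408 · target · rank 0 · closed · moot by None · by planner
why it might fail: (B) fails if an isolated algebraic (x,σ) solution survives all domains at radius 2; (A) is then still provable unless a fugacity-blind family exists (NoFugacityBlindFamilyR2 false).
sources: Literature.Barriers.CriticalPhenomena.not_hasExactVertexRelationZ2, JacobsenScullardGuttmann2016, GlazmanManolescu2019, IkhlefCardy2009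
[target] X = (A) ∧ (B): (A) a non-trivial exact radius-2 stencil identity (rational spin in [0,4),
16 edges incident to the 4-valent ball B₁(v), all bounded domains, all leaf roots) for the ℤ²
mid-edge SAW observable at x = criticalFugacity forces IsAlgebraic ℚ criticalFugacity; (B) no such
identity holds at any x ∈ (0,1). -/
@[route_item "route-CriticalPhenomena-SAWAlgebraicCriticalPoint"]
def NoCriticalStencilIdentity : Prop :=
  let Rel : (m : ℕ) → (Fin m → ℚ) → Finset (Literature.Probability.LatticeModels.Site 2) → Finset (Literature.Probability.LatticeModels.Site 2 × Fin 2) → (Fin m → Literature.Probability.LatticeModels.Site 2 → Fin 2 → ℂ) → ℝ → Prop := fun m σ G E c x => ∀ (Ω : _root_.Set ℂ) (δ : ℝ) (a v : Literature.Probability.LatticeModels.Site 2), 0 < δ → Bornology.IsBounded Ω → a ∈ Literature.Probability.LatticeModels.meshDomain Ω δ → (∃ w : Literature.Probability.LatticeModels.Site 2, (Literature.Probability.LatticeModels.zdGraph 2).Adj a w ∧ Literature.Probability.LatticeModels.meshPoint δ w ∉ Ω) → (∃! u : Literature.Probability.LatticeModels.Site 2, (Literature.Probability.LatticeModels.discreteDomainGraph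 Ω δ).Adj a u) → (∀ p ∈ G, ∀ i : Fin 4, (Literature.Probability.LatticeModels.discreteDomainGraph Ω δ).Adj (v + p) (v + p + (![![1, 0], ![0, 1], ![-1, 0], ![0, -1]] : Fin 4 → Literature.Probability.LatticeModels.Site 2) i)) → ∑ j : Fin m, ∑ e ∈ E, c j e.1 e.2 * Literature.Probability.RandomPlanarGeometry.SAW.midEdgeParafermionicObservable Ω δ a x (σ j) s(v + e.1, v + e.1 + Pi.single e.2 1) = 0; let B1 : Finset (Literature.Probability.LatticeModels.Site 2) := {0, ![1, 0], ![0, 1], ![-1, 0], ![0, -1]}; let E2 : Finset (Literature.Probability.LatticeModels.Site 2 × Fin 2) := {(0, 0), (0, 1), (![-1, 0], 0), (![0, -1], 1), (![1, 0], 0), (![1, 0], 1), (![1, -1], 1), (![0, 1], 0), (![0, 1], 1), (![-1, 1], 0), (![-1, 0], 1), (![-2, 0], 0), (![-1, -1], 1), (![0, -1], 0), (![-1, -1], 0), (![0, -2], 1)}; (∀ (σ : ℚ) (c : Literature.Probability.LatticeModels.Site 2 → Fin 2 → ℂ), 0 ≤ σ → σ < 4 → (∃ e ∈ E2, c e.1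 e.2 ≠ 0) → Rel 1 (fun _ => σ) B1 E2 (fun _ => c) Literature.Probability.RandomPlanarGeometry.SAW.criticalFugacity → IsAlgebraic ℚ Literature.Probability.RandomPlanarGeometry.SAW.criticalFugacity) ∧ (∀ (σ : ℚ) (x : ℝ) (c : Literature.Probability.LatticeModels.Site 2 → Fin 2 → ℂ), 0 ≤ σ → σ < 4 → 0 < x → x < 1 → (∃ e ∈ E2, c e.1 e.2 ≠ 0) → ¬ Rel 1 (fun _ => σ) B1 E2 (fun _ => c) x)

/-- item stmt-CriticalPhenomena-6409 · crux · rank 2 · closed · moot by None · by planner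
why it might fail: A fugacity-blind identity could come from walk-wise phase cancellations richer than single-walk ones: the half-edge variant already carries all-x families 1+λt+λ̄t⁻¹=0 at special spins (barrier scope_caveats (b)), and the 16-value radius-2 space has never been scanned.
sources: Literature.Barriers.CriticalPhenomena.NienhuisWeightsExcludeVertexSAW, IkhlefCardy2009, arXiv:1402.0937, GlazmanManolescu2019
[crux] [card r3 'all-x nullspace scan', radius 2] for every rational spin σ ∈ [0,4) there is NO
fugacity-blind family: it is not the case that for every real x some non-trivial coefficient table
on the 16 edges incident to B₁(v) gives an exact identity Σ_e c_e F^{x,σ}(e) = 0 on all bounded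
domains, leaf roots and 4-valent placements. Decidable per spin class by exact linear algebra over
ℚ(ζ)(x) (rank of the stacked relation matrix of finitely many domains); most informative item: its
failure is an exact 'massive' discrete holomorphicity for the ℤ² SAW, its success makes (A) a
theorem. [difficulty: L] -/
@[route_item "route-CriticalPhenomena-SAWAlgebraicCriticalPoint"]
def NoFugacityBlindFamilyR2 : Prop :=
  let Rel : (m : ℕ) → (Fin m → ℚ) → Finset (Literature.Probability.LatticeModels.Site 2) → Finset (Literature.Probability.LatticeModels.Site 2 × Fin 2) → (Fin m → Literature.Probability.LatticeModels.Site 2 → Fin 2 → ℂ) → ℝ → Prop := fun m σ G E c x => ∀ (Ω : _root_.Set ℂ) (δ : ℝ) (a v : Literature.Probability.LatticeModels.Site 2), 0 < δ → Bornology.IsBounded Ω → a ∈ Literature.Probability.LatticeModels.meshDomain Ω δ → (∃ w : Literature.Probability.LatticeModels.Site 2, (Literature.Probability.LatticeModels.zdGraph 2).Adj a w ∧ Literature.Probability.LatticeModels.meshPoint δ w ∉ Ω) → (∃! u : Literature.Probability.LatticeModels.Site 2, (Literature.Probability.LatticeModels.discreteDomainGraph Ω δ).Adj a u) → (∀ p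 ∈ G, ∀ i : Fin 4, (Literature.Probability.LatticeModels.discreteDomainGraph Ω δ).Adj (v + p) (v + p + (![![1, 0], ![0, 1], ![-1, 0], ![0, -1]] : Fin 4 → Literature.Probability.LatticeModels.Site 2) i)) → ∑ j : Fin m, ∑ e ∈ E, c j e.1 e.2 * Literature.Probability.RandomPlanarGeometry.SAW.midEdgeParafermionicObservable Ω δ a x (σ j) s(v + e.1, v + e.1 + Pi.single e.2 1) = 0; let B1 : Finset (Literature.Probability.LatticeModels.Site 2) := {0, ![1, 0], ![0, 1], ![-1, 0], ![0, -1]}; let E2 : Finset (Literature.Probability.LatticeModels.Site 2 × Fin 2) := {(0, 0), (0, 1), (![-1, 0], 0), (![0, -1], 1), (![1, 0], 0), (![1, 0], 1), (![1, -1], 1), (![0, 1], 0), (![0, 1], 1), (![-1, 1], 0), (![-1, 0], 1), (![-2, 0], 0), (![-1, -1], 1), (![0, -1], 0), (![-1, -1], 0), (![0, -2], 1)}; ∀ σ : ℚ, 0 ≤ σ → σ < 4 → ¬ ∀ x : ℝ, ∃ c : Literature.Probability.LatticeModels.Site 2 → Fin 2 → ℂ, (∃ e ∈ E2, c e.1 e.2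 ≠ 0) ∧ Rel 1 (fun _ => σ) B1 E2 (fun _ => c) x

/-- item stmt-CriticalPhenomena-6410 · crux · rank 3 · closed · moot by None · by planner
why it might fail: Isolated (x,σ) solutions do occur domain-by-domain — the 3×3, 4×3, 5×5 blocks admit block-dependent spins σ≈0.605 with the CR stencil (barrier scope_caveats (a)); with 16 coefficients an isolated algebraic pair might survive every domain.
sources: Literature.Barriers.CriticalPhenomena.not_hasExactVertexRelationZ2, DuminilCopinSmirnov2012, BeatonGuttmannJensen2012, GlazmanManolescu2019
[crux] [unconditional extension of the audited no-go one stencil size up] for every rational spin σ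
∈ [0,4), every x ∈ (0,1) and every non-trivial coefficient table on the 16 edges incident to B₁(v),
the exact identity fails in some bounded domain with a leaf root at some 4-valent placement. Route
to a proof: NoFugacityBlindFamilyR2's certificate (full column rank over ℚ(ζ)(x)) plus exclusion of
the finitely many common roots of the maximal minors in (0,1) by one more domain each, as in the
audit's elimination (vertexStencil_eq_zero_of_rows); the audit's plus-shaped domains impose nothing
here (no 4-valent ball), so new certificate domains are needed. [deps: NoFugacityBlindFamilyR2]
[difficulty: L] -/
@[route_item "route-CriticalPhenomena-SAWAlgebraicCriticalPoint"]
def NoRadiusTwoRelation : Prop :=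
  let Rel : (m : ℕ) → (Fin m → ℚ) → Finset (Literature.Probability.LatticeModels.Site 2) → Finset (Literature.Probability.LatticeModels.Site 2 × Fin 2) → (Fin m → Literature.Probability.LatticeModels.Site 2 → Fin 2 → ℂ) → ℝ → Prop := fun m σ G E c x => ∀ (Ω : _root_.Set ℂ) (δ : ℝ) (a v : Literature.Probability.LatticeModels.Site 2), 0 < δ → Bornology.IsBounded Ω → a ∈ Literature.Probability.LatticeModels.meshDomain Ω δ → (∃ w : Literature.Probability.LatticeModels.Site 2, (Literature.Probability.LatticeModels.zdGraph 2).Adj a w ∧ Literature.Probability.LatticeModels.meshPoint δ w ∉ Ω) → (∃! u : Literature.Probability.LatticeModels.Site 2, (Literature.Probability.LatticeModels.discreteDomainGraph Ω δ).Adj a u) → (∀ p ∈ G, ∀ i : Fin 4, (Literature.Probability.LatticeModels.discreteDomainGraph Ω δ).Adj (v + p) (v + p + (![![1, 0], ![0, 1], ![-1, 0], ![0, -1]] : Fin 4 → Literature.Probability.LatticeModels.Site 2) i)) → ∑ j : Fin m, ∑ e ∈ E, c j e.1 e.2 * Literature.Probability.RandomPlanarGeometry.SAW.midEdgeParafermionicObservable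 Ω δ a x (σ j) s(v + e.1, v + e.1 + Pi.single e.2 1) = 0; let B1 : Finset (Literature.Probability.LatticeModels.Site 2) := {0, ![1, 0], ![0, 1], ![-1, 0], ![0, -1]}; let E2 : Finset (Literature.Probability.LatticeModels.Site 2 × Fin 2) := {(0, 0), (0, 1), (![-1, 0], 0), (![0, -1], 1), (![1, 0], 0), (![1, 0], 1), (![1, -1], 1), (![0, 1], 0), (![0, 1], 1), (![-1, 1], 0), (![-1, 0], 1), (![-2, 0], 0), (![-1, -1], 1), (![0, -1], 0), (![-1, -1], 0), (![0, -2], 1)}; ∀ (σ : ℚ) (x : ℝ) (c : Literature.Probability.LatticeModels.Site 2 → Fin 2 → ℂ), 0 ≤ σ → σ < 4 → 0 < x → x < 1 → (∃ e ∈ E2, c e.1 e.2 ≠ 0) → ¬ Rel 1 (fun _ => σ) B1 E2 (fun _ => c) x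

/-- item stmt-CriticalPhenomena-6411 · support · rank 9 · closed · moot by None · by planner
sources: JacobsenScullardGuttmann2016, IkhlefCardy2009
[support] [the card's Claim D, instantiated; provable now] for every finite stencil type (m rational
spins, any finite guard G of offsets required 4-valent, any finite set E of canonical edges,
coefficients c ≠ 0 on E) and every real x₀: if the exact identity holds at x₀ on all bounded domains
/ leaf roots / guarded placements, then x₀ is algebraic over ℚ OR for every real x some non-trivial
c' of the same type gives the identity at x (a fugacity-blind family). Proof sketch: on a bounded
domain each F^{x,σ}(e) is a polynomial in x with coefficients in ℤ[ζ_N] (finite sum of e^{-iσW}x^n,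
W ∈ (π/2)ℤ); if some x₁ carries no identity, finitely many domains already kill it, a maximal minor
D ∈ ℚ(ζ_N)[x] of their stacked matrix is non-zero and vanishes at x₀. [difficulty: M] -/
@[route_item "route-CriticalPhenomena-SAWAlgebraicCriticalPoint"]
def StencilDichotomy : Prop :=
  let Rel : (m : ℕ) → (Fin m → ℚ) → Finset (Literature.Probability.LatticeModels.Site 2) → Finset (Literature.Probability.LatticeModels.Site 2 × Fin 2) → (Fin m → Literature.Probability.LatticeModels.Site 2 → Fin 2 → ℂ) → ℝ → Prop := fun m σ G E c x => ∀ (Ω : _root_.Set ℂ) (δ : ℝ) (a v : Literature.Probability.LatticeModels.Site 2), 0 < δ → Bornology.IsBounded Ω → a ∈ Literature.Probability.LatticeModels.meshDomain Ω δ → (∃ w : Literature.Probability.LatticeModels.Site 2, (Literature.Probability.LatticeModels.zdGraph 2).Adj a w ∧ Literature.Probability.LatticeModels.meshPoint δ w ∉ Ω) → (∃! u : Literature.Probability.LatticeModels.Site 2, (Literature.Probability.LatticeModels.discreteDomainGraph Ω δ).Adj a u) → (∀ p ∈ G, ∀ i : Fin 4, (Literature.Probability.LatticeModels.discreteDomainGraph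 Ω δ).Adj (v + p) (v + p + (![![1, 0], ![0, 1], ![-1, 0], ![0, -1]] : Fin 4 → Literature.Probability.LatticeModels.Site 2) i)) → ∑ j : Fin m, ∑ e ∈ E, c j e.1 e.2 * Literature.Probability.RandomPlanarGeometry.SAW.midEdgeParafermionicObservable Ω δ a x (σ j) s(v + e.1, v + e.1 + Pi.single e.2 1) = 0; ∀ (m : ℕ) (σ : Fin m → ℚ) (G : Finset (Literature.Probability.LatticeModels.Site 2)) (E : Finset (Literature.Probability.LatticeModels.Site 2 × Fin 2)) (x₀ : ℝ) (c : Fin m → Literature.Probability.LatticeModels.Site 2 → Fin 2 → ℂ), (∃ j : Fin m, ∃ e ∈ E, c j e.1 e.2 ≠ 0) → Rel m σ G E c x₀ → IsAlgebraic ℚ x₀ ∨ ∀ x : ℝ, ∃ c' : Fin m → Literature.Probability.LatticeModels.Site 2 → Fin 2 → ℂ, (∃ j : Fin m, ∃ e ∈ E, c' j e.1 e.2 ≠ 0) ∧ Rel m σ G E c' x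

/-- item stmt-CriticalPhenomena-6412 · support · rank 9 · closed · moot by None · by planner
sources: JacobsenScullardGuttmann2016
[support] [pure algebra behind StencilDichotomy; provable now] for any family of row vectors of
polynomials over ℂ with algebraic coefficients (rows indexed by an arbitrary type, n columns) and x₀
∈ ℂ: if the rows evaluated at x₀ have a common non-zero kernel vector then either x₀ is algebraic
over ℚ or the rows evaluated at every x ∈ ℂ have a common non-zero kernel vector.
(Finite-dimensional descending-chain argument + one non-vanishing maximal minor; no Noetherianity,
no function fields needed.) [difficulty: provable-now] -/
@[route_item "route-CriticalPhenomena-SAWAlgebraicCriticalPoint"]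
def AbstractDichotomy : Prop :=
  ∀ (ι : Type) (n : ℕ) (P : ι → Fin n → Polynomial ℂ), (∀ i j k, IsAlgebraic ℚ ((P i j).coeff k)) → ∀ x₀ : ℂ, (∃ c : Fin n → ℂ, c ≠ 0 ∧ ∀ i, ∑ j, (P i j).eval x₀ * c j = 0) → IsAlgebraic ℚ x₀ ∨ ∀ x : ℂ, ∃ c : Fin n → ℂ, c ≠ 0 ∧ ∀ i, ∑ j, (P i j).eval x * c j = 0

/-- item stmt-CriticalPhenomena-6413 · support · rank 9 · closed · moot by None · by planner
sources: DuminilCopinSmirnov2012, Literature.Barriers.CriticalPhenomena.NienhuisWeightsExcludeVertexSAW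
[support] [why single spins suffice; provable now] on leaf-rooted bounded domains a multi-character
identity (spins pairwise distinct mod 4, stencil edges within reach of the guard, x ≠ 0) holds only
if each single-character component holds separately. Proof sketch: prefix the domain by a width-1
corridor spiralling s times around it and starting in an arbitrary direction — every walk acquires
the same extra winding k₀ (any integer is realisable) and length, so the identity for the composite
domain reads Σ_j t_j^{k₀} EQ_j = 0 with t_j = e^{-iπσ_j/2} pairwise distinct: a Vandermonde system
forcing EQ_j = 0 for each j. Hence the card's 'winding-class memory' adds nothing at fixed stencil,
and (A)/(B) extend verbatim to arbitrary finite spin sets. [difficulty: M] -/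
@[route_item "route-CriticalPhenomena-SAWAlgebraicCriticalPoint"]
def CharacterDecoupling : Prop :=
  let Rel : (m : ℕ) → (Fin m → ℚ) → Finset (Literature.Probability.LatticeModels.Site 2) → Finset (Literature.Probability.LatticeModels.Site 2 × Fin 2) → (Fin m → Literature.Probability.LatticeModels.Site 2 → Fin 2 → ℂ) → ℝ → Prop := fun m σ G E c x => ∀ (Ω : _root_.Set ℂ) (δ : ℝ) (a v : Literature.Probability.LatticeModels.Site 2), 0 < δ → Bornology.IsBounded Ω → a ∈ Literature.Probability.LatticeModels.meshDomain Ω δ → (∃ w : Literature.Probability.LatticeModels.Site 2, (Literature.Probability.LatticeModels.zdGraph 2).Adj a w ∧ Literature.Probability.LatticeModels.meshPoint δ w ∉ Ω) → (∃! u : Literature.Probability.LatticeModels.Site 2, (Literature.Probability.LatticeModels.discreteDomainGraph Ω δ).Adj a u) → (∀ p ∈ G, ∀ i : Fin 4, (Literature.Probability.LatticeModels.discreteDomainGraph Ω δ).Adj (v + p) (v + p + (![![1, 0], ![0, 1], ![-1, 0], ![0, -1]] : Fin 4 → Literature.Probability.LatticeModels.Site 2) i)) → ∑ j : Fin m, ∑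 e ∈ E, c j e.1 e.2 * Literature.Probability.RandomPlanarGeometry.SAW.midEdgeParafermionicObservable Ω δ a x (σ j) s(v + e.1, v + e.1 + Pi.single e.2 1) = 0; ∀ (m : ℕ) (σ : Fin m → ℚ) (G : Finset (Literature.Probability.LatticeModels.Site 2)) (E : Finset (Literature.Probability.LatticeModels.Site 2 × Fin 2)) (c : Fin m → Literature.Probability.LatticeModels.Site 2 → Fin 2 → ℂ) (x : ℝ), (∀ j j' : Fin m, (∃ z : ℤ, σ j - σ j' = 4 * z) → j = j') → (∀ e ∈ E, e.1 ∈ G ∨ e.1 + Pi.single e.2 1 ∈ G) → x ≠ 0 → Rel m σ G E c x → ∀ j : Fin m, Rel 1 (fun _ => σ j) G E (fun _ => c j) x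

/-- item stmt-CriticalPhenomena-6414 · support · rank 9 · closed · moot by None · by planner
sources: Literature.Barriers.CriticalPhenomena.not_hasExactVertexRelationZ2, DuminilCopinSmirnov2012
[support] [radius-1 calibration = the audited barrier theorem in this route's conventions; provable
now] for every rational spin, every x ∈ (0,1) and every non-trivial table on the 4 edges at v, the
single-vertex identity (guard {v}) fails on some bounded leaf-rooted domain — adapt
Literature.Barriers.CriticalPhenomena.not_hasExactVertexRelationZ2 (its six domains P, T, O are
bounded and every root used is a leaf; the enumeration lemmas
Literature.Barriers.CriticalPhenomena.NoVertexRelation.* are reusable). [difficulty: provable-now] -/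
@[route_item "route-CriticalPhenomena-SAWAlgebraicCriticalPoint"]
def NoVertexRelationLeaf : Prop :=
  let Rel : (m : ℕ) → (Fin m → ℚ) → Finset (Literature.Probability.LatticeModels.Site 2) → Finset (Literature.Probability.LatticeModels.Site 2 × Fin 2) → (Fin m → Literature.Probability.LatticeModels.Site 2 → Fin 2 → ℂ) → ℝ → Prop := fun m σ G E c x => ∀ (Ω : _root_.Set ℂ) (δ : ℝ) (a v : Literature.Probability.LatticeModels.Site 2), 0 < δ → Bornology.IsBounded Ω → a ∈ Literature.Probability.LatticeModels.meshDomain Ω δ → (∃ w : Literature.Probability.LatticeModels.Site 2, (Literature.Probability.LatticeModels.zdGraph 2).Adj a w ∧ Literature.Probability.LatticeModels.meshPoint δ w ∉ Ω) → (∃! u : Literature.Probability.LatticeModels.Site 2, (Literature.Probability.LatticeModels.discreteDomainGraph Ω δ).Adj a u) → (∀ p ∈ G, ∀ i : Fin 4, (Literature.Probability.LatticeModels.discreteDomainGraph Ω δ).Adj (v + p) (v + p + (![![1, 0], ![0, 1], ![-1, 0], ![0, -1]] : Fin 4 → Literature.Probability.LatticeModels.Site 2) i)) → ∑ j : Fin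 m, ∑ e ∈ E, c j e.1 e.2 * Literature.Probability.RandomPlanarGeometry.SAW.midEdgeParafermionicObservable Ω δ a x (σ j) s(v + e.1, v + e.1 + Pi.single e.2 1) = 0; let G1 : Finset (Literature.Probability.LatticeModels.Site 2) := {0}; let E1 : Finset (Literature.Probability.LatticeModels.Site 2 × Fin 2) := {(0, 0), (0, 1), (![-1, 0], 0), (![0, -1], 1)}; ∀ (σ : ℚ) (x : ℝ) (c : Literature.Probability.LatticeModels.Site 2 → Fin 2 → ℂ), 0 < x → x < 1 → (∃ e ∈ E1, c e.1 e.2 ≠ 0) → ¬ Rel 1 (fun _ => σ) G1 E1 (fun _ => c) x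

/-- item stmt-CriticalPhenomena-6415 · assembly · rank 1 · closed · moot by None · by planner
sources: Literature.Barriers.CriticalPhenomena.NienhuisWeightsExcludeVertexSAW
[assembly] StencilDichotomy → NoFugacityBlindFamilyR2 → NoRadiusTwoRelation →
NoCriticalStencilIdentity (conclusion = the barrier target X, by declaration not the conjunct). -/
@[route_item "route-CriticalPhenomena-SAWAlgebraicCriticalPoint"]
def Assembly : Prop :=
  StencilDichotomy → NoFugacityBlindFamilyR2 → NoRadiusTwoRelation → NoCriticalStencilIdentity

end Summit.CriticalPhenomena.SAWScalingLimit.Theses.SAWAlgebraicCriticalPoint
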